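/-
Width seat `ym-line-sgb-p1-w3` (gen 2, seat prover-ym-line-sgb-p1-w3-g2-0), route `SteinGapBootstrap`, crux U `FreeProbeLawG`
(stmt-QuantumFields-23756), line `birth` (lead ym-line-sgb-k1-g1, RESHAPE 2), registered stub `stub_blockGreen`.
-/
import Summits.QuantumFields.YangMills.Theorems.SteinGapBootstrapFreeProbeLawGStubBlockGreenPrep
import HarnessLib

/-!
# Line `birth` of crux U `FreeProbeLawG`: stub `stub_blockGreen` — PROVED

NOT THE CLAY GAP: route `SteinGapBootstrap` bears on the RECORD-label rung leaf R2ξ′ `WeakCouplingRates.XiPow` (an UPPER bound on the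
lattice mass gap of torus-limit states); U itself stays open (child C1ᶠ `PairSteinDiscrepancyFreeG`, stmt-QuantumFields-23798).

The box-truncated Green `1`-form of a plaquette `p`: `ω = 1_{box R} · ω_∞`, `ω_∞(e) = Σ_a σ_a Γ(∂_a p, e)` (`Γ = edgeGreen`).  The four
clauses: (1) support in the box (definition); (2) `ℓ¹`-mass `≤ Cg (1+R)^4` (`|latticeGreen| ≤ M`, `4(2R+1)^4` edges in the box);
(3) `dω = curvatureTwoPoint p ·` on plaquettes well inside (`dω_∞ = Π(p,·)` exactly); (4) `|Σ(dω)² − Π(p,p)| ≤ Cg(1+R)^{-2}` from the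
reproduction of finitely supported exact forms by the curvature kernel (`stub_kernelFixesExact`) and the gradient decay of the lattice
Green function on the boundary layer (`latticeGreen_gradient_bound`) — see the helper module `…StubBlockGreenPrep`.
Constants: `c = 4`, `γ = 2`, `Cg = 128 M + 15116544 K'²`.

References: G. F. Lawler, Intersections of Random Walks (1991), Thm 1.5.5 [Lawler1991]; G. Lawler, V. Limic, Random Walk: A Modern
Introduction (2010), Thm 4.3.1 [LawlerLimic2010]; C. Garban, A. Sepúlveda, IMRN 2023, §3.3 [GarbanSepulveda2023].
-/

set_option autoImplicit false

noncomputable section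

open Literature.Probability.LatticeModels Literature.MathematicalPhysics.QuantumLattice
  Literature.MathematicalPhysics.QuantumFieldTheory
open Summit.QuantumFields.YangMills.Theorems.EquipartitionPinsProbe

namespace Summit.QuantumFields.YangMills.Cruxes.FreeProbeLawG.SteinFree

open BlockGreen

/-- **Stub `stub_blockGreen` of line `birth` (crux U, stmt-QuantumFields-23756)** — the box-truncated Green `1`-form
`ω = 1_{box R}·Σ_a σ_a Γ(∂_a p, ·)` of a plaquette `p`: supported in the box, `ℓ¹`-mass `≤ Cg(1+R)^4`, curl `= curvatureTwoPoint p ·`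
on plaquettes well inside, and energy `Σ(dω)² = curvatureTwoPoint p p + O((1+R)^{-2})` (reproduction of exact forms by the curvature
kernel + gradient decay of the lattice Green function on the boundary layer).  Constants `c = 4`, `γ = 2`.  NOT THE CLAY GAP. -/
theorem stub_blockGreen :
    ∃ Cg c γ : ℝ, 0 < γ ∧ 0 ≤ Cg ∧ ∀ (p : Literature.MathematicalPhysics.QuantumLattice.ZdPlaquette 4) (R : ℕ), (∀ k : Fin 4, 2 * |p.1 k| + 2 ≤ (R : ℤ)) →
        ∃ ω : Literature.MathematicalPhysics.QuantumLattice.ZdEdge 4 → ℝ,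
          (∀ e, ω e ≠ 0 → ∀ k : Fin 4, |e.1 k| ≤ (R : ℤ)) ∧
          (∀ T : Finset (Literature.MathematicalPhysics.QuantumLattice.ZdEdge 4), ∑ e ∈ T, |ω e| ≤ Cg * (1 + (R : ℝ)) ^ c) ∧
          (∀ q : Literature.MathematicalPhysics.QuantumLattice.ZdPlaquette 4, (∀ k : Fin 4, 2 * |q.1 k| + 2 ≤ (R : ℤ)) →
            Literature.MathematicalPhysics.QuantumFieldTheory.plaquetteCurl ω q = Literature.MathematicalPhysics.QuantumFieldTheory.curvatureTwoPoint p q) ∧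
          (∀ T : Finset (Literature.MathematicalPhysics.QuantumLattice.ZdPlaquette 4), (∀ q, Literature.MathematicalPhysics.QuantumFieldTheory.plaquetteCurl ω q ≠ 0 → q ∈ T) →
            |(∑ q ∈ T, (Literature.MathematicalPhysics.QuantumFieldTheory.plaquetteCurl ω q) ^ 2) - Literature.MathematicalPhysics.QuantumFieldTheory.curvatureTwoPoint p p| ≤ Cg * (1 + (R : ℝ)) ^ (-γ)) := by
  obtain ⟨M, hM0, hM⟩ := exists_abs_latticeGreen_le
  obtain ⟨K', hK'0, hK'⟩ := latticeGreen_gradient_bound (d := 4) (by norm_num)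
  refine ⟨128 * M + 15116544 * K' ^ 2, 4, 2, by norm_num, by positivity, fun p R hR => ?_⟩
  -- the untruncated Green form `w` and its truncation
  set w : ZdEdge 4 → ℝ := fun e => ∑ a : Fin 4, plaquetteBoundarySign a * edgeGreen (plaquetteBoundary p a) e with hw_def
  have hw : ∀ q, plaquetteCurl w q = curvatureTwoPoint p q := plaquetteCurl_greenForm p
  have hR0 : (0 : ℝ) ≤ R := Nat.cast_nonneg R
  have h1R : (0 : ℝ) < 1 + R := by linarith
  refine ⟨fun e => if (∀ k : Fin 4, |e.1 k| ≤ (R : ℤ)) then w e else 0, ?_, ?_, ?_, ?_⟩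
  · -- (1) support
    intro e he
    by_contra h
    exact he (by simp only [if_neg h])
  · -- (2) ℓ¹ mass
    intro T
    have hwb : ∀ e, |w e| ≤ 2 * M := fun e => by
      rw [hw_def]
      simp only
      rw [greenForm_apply]
      have hA : ∀ (c : Prop) [Decidable c] (u v : Site 4), |(if c then (latticeGreen u - latticeGreen v) / 2 else 0)| ≤ M := by
        intro c _ u v
        split_ifs
        · rw [abs_div, abs_two]
          have := abs_sub (latticeGreen u) (latticeGreen v)
          linarith [hM u, hM v]
        · rw [abs_zero]; exact hM0
      have t1 := hA (p.2.1.1 = e.2) (p.1 - e.1) (p.1 + Pi.single p.2.1.2 1 - e.1)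
      have t2 := hA (p.2.1.2 = e.2) (p.1 + Pi.single p.2.1.1 1 - e.1) (p.1 - e.1)
      exact (abs_add_le _ _).trans (by linarith)
    refine (sum_abs_truncate_le R w hwb T).trans ?_
    have e4 : (1 + (R : ℝ)) ^ (4 : ℝ) = (1 + (R : ℝ)) ^ (4 : ℕ) := by
      rw [show (4 : ℝ) = ((4 : ℕ) : ℝ) by norm_num]; exact Real.rpow_natCast _ 4
    rw [e4]
    have h2 : (2 * (R : ℝ) + 1) ^ 4 ≤ 16 * (1 + (R : ℝ)) ^ 4 := by
      have : 2 * (R : ℝ) + 1 ≤ 2 * (1 + (R : ℝ)) := by linarith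
      calc (2 * (R : ℝ) + 1) ^ 4 ≤ (2 * (1 + (R : ℝ))) ^ 4 := pow_le_pow_left₀ (by linarith) this 4
        _ = 16 * (1 + (R : ℝ)) ^ 4 := by ring
    have h3 : (0 : ℝ) ≤ (1 + (R : ℝ)) ^ 4 := by positivity
    nlinarith [sq_nonneg K']
  · -- (3) exact curl well inside
    exact fun q hq => plaquetteCurl_truncate_eq p R w hw q hq
  · -- (4) energy
    intro T hT
    have hfar : ∀ (e : ZdEdge 4) (k₀ : Fin 4), (R : ℤ) ≤ |e.1 k₀| → |w e| ≤ 27 * K' * (1 + (R : ℝ)) ^ (-(3 : ℝ)) :=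
      fun e k₀ he => abs_greenForm_le_far hK'0 hK' p hR e he
    have hm0 : 0 ≤ 27 * K' * (1 + (R : ℝ)) ^ (-(3 : ℝ)) := by positivity
    refine (abs_energy_sub_le p R w hw hR hm0 hfar T hT).trans ?_
    -- `256 (2R+3)^4 (27K')² (1+R)^{-6} ≤ 15116544 K'² (1+R)^{-2} ≤ Cg (1+R)^{-2}`
    have h3 : (2 * (R : ℝ) + 3) ^ 4 ≤ 81 * (1 + (R : ℝ)) ^ 4 := by
      have : 2 * (R : ℝ) + 3 ≤ 3 * (1 + (R : ℝ)) := by linarith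
      calc (2 * (R : ℝ) + 3) ^ 4 ≤ (3 * (1 + (R : ℝ))) ^ 4 := pow_le_pow_left₀ (by linarith) this 4
        _ = 81 * (1 + (R : ℝ)) ^ 4 := by ring
    have hpow : (1 + (R : ℝ)) ^ 4 * ((1 + (R : ℝ)) ^ (-(3 : ℝ))) ^ 2 = (1 + (R : ℝ)) ^ (-(2 : ℝ)) := by
      rw [← Real.rpow_natCast _ 4, ← Real.rpow_natCast _ 2, ← Real.rpow_mul h1R.le, ← Real.rpow_add h1R]
      norm_num
    have hb : 0 ≤ (1 + (R : ℝ)) ^ (-(2 : ℝ)) := Real.rpow_nonneg h1R.le _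
    have hb3 : 0 ≤ ((1 + (R : ℝ)) ^ (-(3 : ℝ))) ^ 2 := sq_nonneg _
    calc 256 * (2 * (R : ℝ) + 3) ^ 4 * (27 * K' * (1 + (R : ℝ)) ^ (-(3 : ℝ))) ^ 2
        = 256 * 729 * K' ^ 2 * ((2 * (R : ℝ) + 3) ^ 4 * ((1 + (R : ℝ)) ^ (-(3 : ℝ))) ^ 2) := by ring
      _ ≤ 256 * 729 * K' ^ 2 * (81 * (1 + (R : ℝ)) ^ 4 * ((1 + (R : ℝ)) ^ (-(3 : ℝ))) ^ 2) := by
          gcongr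
      _ = 15116544 * K' ^ 2 * (1 + (R : ℝ)) ^ (-(2 : ℝ)) := by rw [mul_assoc (81 : ℝ), hpow]; ring
      _ ≤ (128 * M + 15116544 * K' ^ 2) * (1 + (R : ℝ)) ^ (-(2 : ℝ)) := by nlinarith

end Summit.QuantumFields.YangMills.Cruxes.FreeProbeLawG.SteinFree

end
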